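import Summits.QuantumFields.BalabanUV.T4Continuum.Support.ShellMeasureLandauEndFinal
import Summits.QuantumFields.BalabanUV.T4Continuum.Support.ShellMeasureWindowRestrict

/-!
# `T4Continuum.ShellMeasureLandauEndWindowRestrict` — row S87 f2 «THE END-SIDE WIRING OF γ3»: the live-level END-II-final
# (S76 f2) with its WINDOW-SUPPORT binder `hFsupp` REPLACED by the reach reading `hreach` — the density restricted to the
# sub-threshold event, the extra indicator riding free as a centre-monotone co-test because the sub-threshold set is
# STAR-SHAPED along the chart contraction ((AN-bound) + (SM), two-point interpolation)
(cell `pub-balaban`, sub-cell `t4`, spine estimate NE7c (node U5b); NE7c ROUND-2 crew, unit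
`b2b-balaban-t4-ne7c-formalise-leaf-03` gen 6; owner table `t4/b2b-balaban-t4-ne7c-p1/LEAVES-NE7c-P1.md` row **S87**
(owner g32: f1 `ShellMeasureWindowRestrict` p228621 + «ROW S87 f2 OPEN for the crew» journal l.18164; CLAIM l.18185);
ADDITIVE — imports S76 f2 `ShellMeasureLandauEndFinal` (p227065) and S87 f1 `ShellMeasureWindowRestrict` (p228621) ONLY;
[folklore]; 0 `def`, 0 `def … : Prop`, 0 sorry, 0 citation tags)

HONEST FRAMING.  Finite four-torus programme, rung (B)+1 only — NOT infinite volume, NOT a mass gap, NOT the Clay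
problem, NOT summit progress; (B), `BetaPertHyp`, (B^μ) not consumed.  NE7c (`T4IndicatorShell.ShellWeightBound`) is
NOT PRINTED in [Balaban 1983–89] and NOT PROVED; «NE7c ⇐ the named binders» (trigger c3); (M1) realized ≠ NE7c.
Nothing printed is asserted: B14 (2.16)∕(2.17), [Balaban1985Averaging] Props 1∕2 and the scheme equation numbers LOCATE
the displayed SHAPES of binders, they are not citations; no estimate of Bałaban's is discharged.  HONEST DEPENDENCY
(cell): continuum YM on T⁴ ⇐ BetaPertH ∧ nine spine estimates (0/9 proved); BetaPertH ⇐ (D1) ∧ (D4) ∧ CAP+tail;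
G-an2-4 gates asym, D1 and NE2/3/4.

THE POINT (owner NOTE N-ne7cp1-g32-2, S87 f1's header).  The live-level ENDs display the WINDOW binder `hFsupp`
(«`F ≠ 0` at a tree-gauged configuration ⟹ every block bond within `2 sin(S∕2)` of the centre»), but at a live slot the
slot's OWN indicator is summed out, so no factor of `F` forces the window.  S87 f1 showed: (M1) for the law with density
`𝟙{u < θ}·F` implies (M1) for the law with density `F` (SAME constant), and `𝟙{u < θ}·F` meets `hFsupp` from ONE reach
reading `hreach : u < θ ⟹ block bonds in the window`.  THIS FILE does the END-side wiring the owner left to the crew: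
S76 f2 `slotAC_realized_su2_landauChart_final` is applied to `F′ := 𝟙{u < θ}·F` with the co-test
`Jco′ V x := 𝟙{u(section V x) < θ}·Jco V x` (S87 f1 `indicator_mul_section`), and the one non-trivial primed binder —
the CENTRE-MONOTONICITY `hJ′` of the extra indicator — is RE-DERIVED from what the END already derives internally:
* §1 **`sup_norm_lt_of_contraction`**: for a finite family of functionals analytic on the disc `‖w‖ < R` (`R > 1`) with
  sup `H`, vanishing at `0`, and the smallness (SM) `36H∕(R−1)² ≤ δθ` (`0 ≤ δ ≤ 1`): every `‖f_p(1)‖ < θ` ⟹ every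
  `‖f_p(c)‖ < θ` for ALL `0 < c ≤ 1` — `ShellMeasureInterpAnalytic.coreMap_of_interp` at `ρ := 0` (the depth condition
  `c(1 + δ(1−c)) ≤ 1` holds for every `c ∈ (0,1]`); i.e. THE SUB-THRESHOLD SET IS STAR-SHAPED along the contraction;
* §2 **`classifier_lt_of_contraction`**: the same for `ShellMeasureLevelAssembly.classifier` given the (AN-bound) data in
  the shape S73 `hAN_landau_chartRay_stokes` produces; `mem_cube_of_mem_closedBall`, `exp_neg_smul_mem_closedBall`;
* §3 **`slotAC_realized_su2_landauChart_final_of_reach`** — THE END: S76 f2's binders VERBATIM except `hFsupp`, REPLACED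
  by `hreach : u (fixTo T U₀ (V[Λ := y])) < εθ·η² → ∀ b ∈ Λ, dist1 ((c V b)⁻¹ y_b) ≤ 2 sin(S∕2)`; conclusion IDENTICAL:
  `SlotAntiConcentration ((fieldMeasure P j SU2).withDensity F) u (εθ·η²) ρ (2(m₀ + (B_W + B_E))∕(1−δ))`.  Proof: the
  printed smallness gives the scheme numerics (`ShellMeasureLandauPrinted`), S73 gives the classifier's (AN-bound) in the
  Stokes currency and `hSM_of_stokes` the smallness, §2 makes `{x | u(section V x) < θ}` star-shaped on the window, so
  `Jco′` is centre-monotone (`hJ′`), supported in `W` (`hJW′`), `≤ 1` (`hJ1′`); `hF′`∕`hFi′`∕`hFsupp′`∕`hRdict′` by S87 f1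
  (`measurable_indicator_density`, `indicator_mul_invariant`, the reach, the section identity); then S76 f2, then S87 f1
  `slotAntiConcentration_withDensity_of_indicator`.
WHAT REMAINS DISPLAYED (c3): exactly S76 f2's located inputs with `hFsupp` traded for the reach READING `hreach` (located,
printed TYPE — B14 (2.16)∕(2.17) + average regularity on `□^{∼4}`; NOT asserted, NOT discharged); [dict] node O.  NOTHING in
the countdown moves; NE7c NOT PROVED; spine PROVED 0∕9.
-/

noncomputable section

open Set Metric NormedSpace MeasureTheory Function

namespace Summit.QuantumFields.BalabanUV.T4Continuum.ShellMeasureLandauEndWindowRestrict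

open scoped ENNReal
open Literature.MathematicalPhysics.QuantumFieldTheory.Balaban1983to89
open B11Prop6Scheme (Prop4Hyp)
open GaugeField (GaugeInvariant)
open T4ShellMeasure (SlotAntiConcentration)
open T4CubePoincare (cube)
open T4CubeChartGnomonic (SU2)
open T4CubeChartExp (expFibreChart)
open T4TreeGaugeFixing (NoClosedLoop fixTo)
open T4ShellMeasurePlaquette (expTail₂)
open ShellMeasureLevelAssembly (classifier)
open ShellMeasureLandauHolonomy (solAt landauExp)
open ShellMeasureLandauHolonomyChart (holOf cplx)
open ShellMeasureLandauHolonomySkew (readOutReal)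
open ShellMeasureLandauHolonomyStokes (hAN_landau_chartRay_stokes hSM_of_stokes)
open ShellMeasureLandauPrinted (scheme_numbers_of_printed sectC_numbers_of_printed)
open ShellMeasureInterpAnalytic (coreMap_of_interp interp_of_differentiableOn_ball_le)
open ShellMeasureLandauEndFinal (slotAC_realized_su2_landauChart_final)
open ShellMeasureWindowRestrict (measurable_indicator_density indicator_mul_invariant
  slotAntiConcentration_withDensity_of_indicator)

/-! ## §1 The sub-threshold set of an analytic family is star-shaped along the contraction -/

section Star

variable {F : Type*} [NormedAddCommGroup F] [NormedSpace ℂ F] [CompleteSpace F]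

/-- the depth condition of `coreMap_of_interp` at `ρ = 0` holds at EVERY depth: `c(1 + δ(1−c)) ≤ 1` for `0 < c ≤ 1`,
`0 ≤ δ ≤ 1`. [folklore] -/
theorem depth_le_one {c δ : ℝ} (hc0 : 0 < c) (hc1 : c ≤ 1) (hδ0 : 0 ≤ δ) (hδ1 : δ ≤ 1) :
    c * (1 + δ * (1 - c)) ≤ 1 - 0 := by
  have h1c : 0 ≤ 1 - c := by linarith
  have hcc : 0 ≤ c * (1 - c) := mul_nonneg hc0.le h1c
  have h1 : δ * (c * (1 - c)) ≤ 1 * (c * (1 - c)) := mul_le_mul_of_nonneg_right hδ1 hcc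
  have h2 : c * (1 - c) ≤ 1 * (1 - c) := mul_le_mul_of_nonneg_right hc1 h1c
  have _h3 := hδ0
  nlinarith

/-- **THE SUB-THRESHOLD SET IS STAR-SHAPED ALONG THE CONTRACTION.**  A non-empty finite family `f p : ℂ → F`, each
complex differentiable with `‖f p‖ ≤ H` on `‖w‖ < R` (`R > 1`) and `f p 0 = 0`; the smallness (SM)
`36·H·1²∕(R − 1)² ≤ δ·θ` with `0 ≤ δ ≤ 1`, `θ > 0`.  If every `‖f p 1‖ < θ` then every `‖f p c‖ < θ` for ALL `0 < c ≤ 1`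
(`ShellMeasureInterpAnalytic.coreMap_of_interp` at `ρ := 0` over `interp_of_differentiableOn_ball_le` at `x₀ = z₀ = 1`).
[folklore] -/
theorem sup_norm_lt_of_contraction {ι : Type*} {Ps : Finset ι} (hPs : Ps.Nonempty) {f : ι → ℂ → F}
    {R H θ δ : ℝ} (hR : 1 < R)
    (hf : ∀ p ∈ Ps, DifferentiableOn ℂ (f p) (ball 0 R)) (hH : ∀ p ∈ Ps, ∀ w ∈ ball (0 : ℂ) R, ‖f p w‖ ≤ H)
    (hf0 : ∀ p ∈ Ps, f p 0 = 0) (hθ : 0 < θ) (hδ0 : 0 ≤ δ) (hδ1 : δ ≤ 1)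
    (hSM : 36 * H * 1 ^ 2 / (R - 1) ^ 2 ≤ δ * θ) {c : ℝ} (hc0 : 0 < c) (hc1 : c ≤ 1)
    (h1 : Ps.sup' hPs (fun p => ‖f p ((1 : ℝ) : ℂ)‖) < θ) :
    Ps.sup' hPs (fun p => ‖f p (c : ℂ)‖) < θ := by
  have key := coreMap_of_interp hPs (fun p (c : ℝ) => f p ((c * 1 : ℝ) : ℂ)) (ρ := 0) hc0 hc1 hθ hSM
    (fun p hp => by
      simpa only [one_mul] using
        interp_of_differentiableOn_ball_le one_pos hR (hf p hp) (hH p hp) (hf0 p hp) ⟨one_pos, le_rfl⟩ hc0 hc1)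
    (depth_le_one hc0 hc1 hδ0 hδ1) (by simpa only [one_mul] using h1)
  simpa only [mul_one, sub_zero] using key

end Star

/-! ## §2 The classifier's sub-threshold set is star-shaped, given the (AN-bound) data -/

section Classifier

variable {E : Type*} [AddCommGroup E] [Module ℝ E]
variable {A : Type*} [NormedRing A] [NormedAlgebra ℂ A] [CompleteSpace A]

/-- **THE CLASSIFIER'S SUB-THRESHOLD SET IS STAR-SHAPED.**  For `classifier hPu hol x = max_{p∈P_u} ‖hol p x − 1‖` and the
(AN-bound) data AT THE POINT `x` in the shape S73 `hAN_landau_chartRay_stokes` produces (per `p ∈ P_u` an `f : ℂ → A`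
complex differentiable with `‖f‖ ≤ H` on `‖w‖ < R`, `f 0 = 0`, `f c = hol p (c • x) − 1` for `0 ≤ c ≤ 1`), `R > 1`,
the smallness `36·H·1²∕(R − 1)² ≤ δ·θ`, `0 ≤ δ ≤ 1`, `θ > 0`: `classifier x < θ ⟹ classifier (c • x) < θ` for all
`0 < c ≤ 1`. [folklore] -/
theorem classifier_lt_of_contraction {ι : Type*} {Pu : Finset ι} (hPu : Pu.Nonempty) (hol : ι → E → A)
    {R H θ δ : ℝ} (hR : 1 < R) (hθ : 0 < θ) (hδ0 : 0 ≤ δ) (hδ1 : δ ≤ 1)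
    (hSM : 36 * H * 1 ^ 2 / (R - 1) ^ 2 ≤ δ * θ) {x : E}
    (hAN : ∀ p ∈ Pu, ∃ f : ℂ → A, DifferentiableOn ℂ f (ball 0 R) ∧ (∀ w ∈ ball (0 : ℂ) R, ‖f w‖ ≤ H) ∧
      f 0 = 0 ∧ ∀ c : ℝ, 0 ≤ c → c ≤ 1 → f (c : ℂ) = hol p (c • x) - 1)
    (h1 : classifier hPu hol x < θ) {c : ℝ} (hc0 : 0 < c) (hc1 : c ≤ 1) :
    classifier hPu hol (c • x) < θ := by
  classical
  choose f hf using hAN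
  have key := sup_norm_lt_of_contraction hPu (f := fun p => if hp : p ∈ Pu then f p hp else 0) hR
    (fun p hp => by simp only [dif_pos hp]; exact (hf p hp).1)
    (fun p hp => by simp only [dif_pos hp]; exact (hf p hp).2.1)
    (fun p hp => by simp only [dif_pos hp]; exact (hf p hp).2.2.1) hθ hδ0 hδ1 hSM hc0 hc1 ?_
  · -- read the conclusion back on `hol`
    unfold classifier
    rw [Finset.sup'_lt_iff] at key ⊢
    intro p hp
    have h := key p hp
    simp only [dif_pos hp] at h
    rwa [(hf p hp).2.2.2 c hc0.le hc1] at h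
  · -- the hypothesis at `c = 1`
    unfold classifier at h1
    rw [Finset.sup'_lt_iff] at h1 ⊢
    intro p hp
    simp only [dif_pos hp]
    rw [(hf p hp).2.2.2 1 zero_le_one le_rfl, one_smul]
    exact h1 p hp

/-- the sup-norm closed ball of `ℝⁿ` is the chart cube `[-S,S]ⁿ`. [folklore] -/
theorem mem_cube_of_mem_closedBall {n : ℕ} {S : ℝ} {x : Fin n → ℝ} (hx : x ∈ closedBall (0 : Fin n → ℝ) S) :
    x ∈ cube n S := by
  rw [T4CubePoincare.cube_eq, Set.mem_univ_pi]
  intro i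
  have h : |x i| ≤ S := by
    have h1 : ‖x i‖ ≤ ‖x‖ := norm_le_pi_norm x i
    rw [Real.norm_eq_abs] at h1
    exact h1.trans (mem_closedBall_zero_iff.1 hx)
  exact Set.mem_Icc.2 (abs_le.1 h)

/-- a contraction `e^{−a} • x`, `a ≥ 0`, stays in the closed ball. [folklore] -/
theorem exp_neg_smul_mem_closedBall {n : ℕ} {S : ℝ} {x : Fin n → ℝ} (hx : x ∈ closedBall (0 : Fin n → ℝ) S)
    {a : ℝ} (ha : 0 ≤ a) : Real.exp (-a) • x ∈ closedBall (0 : Fin n → ℝ) S := by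
  rw [mem_closedBall_zero_iff] at hx ⊢
  have h1 : Real.exp (-a) ≤ 1 := by rw [Real.exp_le_one_iff]; linarith
  calc ‖Real.exp (-a) • x‖ = Real.exp (-a) * ‖x‖ := by rw [norm_smul, Real.norm_of_nonneg (Real.exp_pos _).le]
    _ ≤ 1 * ‖x‖ := mul_le_mul_of_nonneg_right h1 (norm_nonneg _)
    _ ≤ S := by rw [one_mul]; exact hx

end Classifier

/-! ## §3 THE END: S76 f2 with the window binder replaced by the reach reading -/

section Final

open scoped Matrix.Norms.L2Operator

variable {P : Params} {j : ℕ} [DecidableEq (PBond P j)]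
variable {n : Type*} [Fintype n] [DecidableEq n] [Nonempty n]
variable {𝒴 𝒴' 𝒳 𝒵 ℬ : Type*} [NormedAddCommGroup 𝒴] [NormedSpace ℂ 𝒴] [CompleteSpace 𝒴]
  [NormedAddCommGroup 𝒴'] [NormedSpace ℂ 𝒴'] [NormedAddCommGroup 𝒳] [NormedSpace ℂ 𝒳] [CompleteSpace 𝒳]
  [NormedAddCommGroup 𝒵] [NormedSpace ℂ 𝒵] [NormedAddCommGroup ℬ] [NormedSpace ℂ ℬ]

/-- **END-II-FINAL WITH THE WINDOW BINDER REPLACED BY THE REACH READING (row S87 f2).**  Hypotheses: those of S76 f2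
`ShellMeasureLandauEndFinal.slotAC_realized_su2_landauChart_final` VERBATIM (scheme data of the localized tuple, printed
smallness, read-outs with the curl norm, the two 𝓔-ray pairs, the real structure, the dictionary `hRdict`∕`hudict`, the
co-test `Jco` with `hJW`∕`hJ`∕`hJ1`∕`hWS`, the numbers and the η-scalings of (SM)) EXCEPT the window-support binder
`hFsupp`, which is REPLACED by the reach reading `hreach : u(W) < εθ·η² ⟹ every tree-gauged block bond of W within
2 sin(S∕2) of the centre` (owner audit γ3; located, printed TYPE — NOT asserted).  CONCLUSION — IDENTICAL to S76 f2's: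
`SlotAntiConcentration ((fieldMeasure P j SU2).withDensity F) u (εθ·η²) ρ (2(m₀ + (B_W + B_E))∕(1−δ))`.  Proof: S76 f2 for
the RESTRICTED density `𝟙{u < εθη²}·F` with the co-test `Jco·𝟙{u∘section < εθη²}` — centre-monotone by §2 on the (AN-bound)
S73 `hAN_landau_chartRay_stokes` and (SM) `hSM_of_stokes` the END derives anyway — then S87 f1
`slotAntiConcentration_withDensity_of_indicator`.  CONDITIONAL on every binder; NOT Bałaban's minimiser; (M1) realized ≠
NE7c. [folklore] -/
theorem slotAC_realized_su2_landauChart_final_of_reach {T : Finset (PBond P j)} (hT : NoClosedLoop T)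
    (U₀ : GaugeField P j SU2) (Λ : Finset (PBond P j)) {m₀ : ℕ} (e : ↥Λ × Fin 3 ≃ Fin m₀)
    {S : ℝ} (hS : 0 < S) (hSπ : 3 * S ^ 2 < Real.pi ^ 2) (c : GaugeField P j SU2 → GaugeField P j SU2)
    {F : GaugeField P j SU2 → ℝ≥0∞} (hF : Measurable F) (hFi : GaugeInvariant F)
    {u : GaugeField P j SU2 → ℝ} (hu : Measurable u) (hui : GaugeInvariant u)
    {ι : Type*} {Pu : Finset ι} (hPu : Pu.Nonempty)
    (W : GaugeField P j SU2 → Set (Fin m₀ → ℝ)) (Jco : GaugeField P j SU2 → (Fin m₀ → ℝ) → ℝ≥0∞)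
    {δ ρ β : ℝ}
    (𝒢 : GaugeField P j SU2 → (𝒵 →L[ℂ] 𝒴)) (W𝒱 : GaugeField P j SU2 → 𝒴 → 𝒵) {B₀ C₄ a₃ ε₄ : ℝ}
    (h𝒢 : ∀ V f, ‖𝒢 V f‖ ≤ B₀ * ‖f‖) (hW : ∀ V, Prop4Hyp (W𝒱 V) C₄ a₃) (hB₀ : 0 < B₀) (hC₄ : 0 ≤ C₄)
    (hε₄ : 0 ≤ ε₄)
    {dL C₁ B₃ ε₁ : ℝ} (hdL : 0 ≤ dL) (hC₁ : 0 ≤ C₁) (hε₁ : 0 ≤ ε₁) (hB₃ : dL ≤ B₃)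
    (h1 : 2 * B₀ * C₁ * B₃ * ε₁ ≤ ε₄) (h2 : 4 * ε₄ ≤ a₃) (h3 : 16 * B₀ * C₄ * ε₄ ≤ 1)
    (H₁ : GaugeField P j SU2 → (ℬ →L[ℂ] 𝒴)) (hH₁ : ∀ V B, ‖H₁ V B‖ ≤ B₀ * ‖B‖)
    (Φ : GaugeField P j SU2 → (Fin m₀ → ℂ) → ℬ) {rΦ : ℝ} (hΦd : ∀ V, DifferentiableOn ℂ (Φ V) (ball 0 rΦ))
    (hΦ0 : ∀ V, Φ V 0 = 0) (hΦ : ∀ V, ∀ z ∈ ball (0 : Fin m₀ → ℂ) rΦ, ‖Φ V z‖ < 2 * dL * C₁ * ε₁) (hSr : S < rΦ)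
    (Cf : GaugeField P j SU2 → 𝒴' → 𝒳) {C₂ RC : ℝ} (hC₂ : 0 ≤ C₂)
    (hCq : ∀ V, ∀ Z : 𝒴', ‖Z‖ < RC → ‖Cf V Z‖ ≤ C₂ * ‖Z‖ ^ 2) (hCd : ∀ V, DifferentiableOn ℂ (Cf V) (ball 0 RC))
    (ιs : GaugeField P j SU2 → (𝒴 →L[ℂ] 𝒴')) (hι : ∀ V Y, ‖ιs V Y‖ ≤ ‖Y‖)
    (Hop : GaugeField P j SU2 → (𝒳 →L[ℂ] 𝒴)) (hH : ∀ V X, ‖Hop V X‖ ≤ B₀ * ‖X‖)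
    {ε₃ : ℝ} (h18 : 18 * C₂ * B₀ * ε₃ ≤ 1) (hcoup : ε₄ + B₀ * (2 * dL * C₁ * ε₁) ≤ ε₃) (h3R : 3 * ε₃ ≤ RC)
    (ℓs : ι → List (𝒴 →L[ℂ] Matrix n n ℂ)) {κr : ℝ} (hκ : 0 ≤ κr)
    (hℓ : ∀ p ∈ Pu, ∀ ℓ ∈ ℓs p, ∀ Y, ‖ℓ Y‖ ≤ κr * ‖Y‖) {m : ℕ} (hlen : ∀ p ∈ Pu, (ℓs p).length ≤ m)
    {κc : ℝ} (hκc : 0 ≤ κc) (hcurl : ∀ p ∈ Pu, ∀ Y, ‖((ℓs p).map fun ℓ => ℓ Y).sum‖ ≤ κc * ‖Y‖)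
    -- THE TWO 𝓔-SLOTS (R-ne7cp1-g31-1): the WILSON part `𝓔W` (S74 `hE_landau_wilsonSquares(_pinned)` fills `hEW`; the Wilson
    -- density is nonnegative: `hWlb`) and the NON-WILSON part `𝓔E` (S71 f2 ∕ S78 fills `hEE`; a displayed lower bound `hElb`)
    (𝓔W 𝓔E : GaugeField P j SU2 → (Fin m₀ → ℝ) → ℝ) {BW BE BElb : ℝ}
    (hEW : ∀ V, ∀ x ∈ W V, ∀ c' : ℝ, 1 / 2 ≤ c' → c' ≤ 1 → 𝓔W V (c' • x) ≤ 𝓔W V x + (1 - c') * BW) (hBW : 0 ≤ BW)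
    (hEE : ∀ V, ∀ x ∈ W V, ∀ c' : ℝ, 1 / 2 ≤ c' → c' ≤ 1 → 𝓔E V (c' • x) ≤ 𝓔E V x + (1 - c') * BE) (hBE : 0 ≤ BE)
    (hWlb : ∀ V (y : Fin m₀ → ℝ), ‖y‖ ≤ S → 0 ≤ 𝓔W V y)
    (hElb : ∀ V (y : Fin m₀ → ℝ), ‖y‖ ≤ S → -BElb ≤ 𝓔E V y)
    (L : Set (𝒴 →L[ℂ] Matrix n n ℂ))
    (𝓡𝒵 : AddSubgroup 𝒵) (𝓡𝒴' : AddSubgroup 𝒴') (𝓡𝒳 : AddSubgroup 𝒳) (h𝓡𝒳 : IsClosed (𝓡𝒳 : Set 𝒳))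
    (𝓡ℬ : AddSubgroup ℬ)
    (h𝒢r : ∀ V, ∀ f ∈ 𝓡𝒵, 𝒢 V f ∈ readOutReal L) (hWr : ∀ V, ∀ Y ∈ readOutReal L, W𝒱 V Y ∈ 𝓡𝒵)
    (hιr : ∀ V, ∀ Y ∈ readOutReal L, ιs V Y ∈ 𝓡𝒴') (hHr : ∀ V, ∀ X ∈ 𝓡𝒳, Hop V X ∈ readOutReal L)
    (hCr : ∀ V, ∀ Z ∈ 𝓡𝒴', Cf V Z ∈ 𝓡𝒳) (hH₁r : ∀ V, ∀ B ∈ 𝓡ℬ, H₁ V B ∈ readOutReal L)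
    (hΦr : ∀ V, ∀ y : Fin m₀ → ℝ, ‖y‖ ≤ S → Φ V (cplx y) ∈ 𝓡ℬ)
    (hRdict : ∀ V, ∀ x ∈ cube m₀ S,
      F (fixTo T U₀ (updateFinset V Λ (expFibreChart Λ (c V) e x))) =
        Jco V x * ENNReal.ofReal (Real.exp (-(𝓔W V x + 𝓔E V x))))
    (hudict : ∀ V, ∀ x ∈ cube m₀ S,
      u (fixTo T U₀ (updateFinset V Λ (expFibreChart Λ (c V) e x))) =
        classifier hPu (fun p => holOf (ℓs p) (fun y => landauExp (Cf V) (ιs V) (Hop V)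
          (4 * C₂ * (ε₄ + B₀ * (2 * dL * C₁ * ε₁)) ^ 2)
          (solAt (𝒢 V) 0 (W𝒱 V) ε₄ (0 : 𝒵) (H₁ V (Φ V (cplx y))) + H₁ V (Φ V (cplx y))))) x)
    (hJW : ∀ V x, Jco V x ≠ 0 → x ∈ W V)
    (hJ : ∀ V x, ∀ a : ℝ, 0 ≤ a → Jco V x ≤ Jco V (Real.exp (-a) • x))
    (hJ1 : ∀ V x, Jco V x ≤ 1)
    (hWS : ∀ V, W V ⊆ closedBall (0 : Fin m₀ → ℝ) S)
    (hδ0 : 0 ≤ δ) (hδ1 : δ < 1) (hρ0 : 0 ≤ ρ) (hρ : ρ ≤ (1 - δ) / 2) (hβ : 0 ≤ β)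
    -- SM-L2 (SM) DISCHARGED IN THE STOKES CURRENCY (S73 `hSM_of_stokes`): the η-scalings of the classifier's read-out data
    -- DISPLAYED — curl read-out × field size `κ_c·z̄ ≤ c₁η²z` (B11 (25)∕(37) TYPE), letter size `κ_r·z̄ ≤ c₂ηz` ((19) TYPE),
    -- regime `m·κ_r·z̄ ≤ 1` — the UNIT-currency smallness `36(c₁z + m²c₂²z²)∕(r_Φ∕S − 1)² ≤ δ·εθ`, and the classifier
    -- threshold `θ := εθ·η²` (B14 (2.17) TYPE): the `η²` CANCELS
    {η εθ c₁ c₂ z : ℝ} (hη : 0 < η) (hεθ : 0 < εθ)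
    -- THE REACH READING (owner audit γ3, S87 f1 `support_of_indicator_mul`): a SUB-THRESHOLD tested variable puts every
    -- tree-gauged block bond in the window (average regularity on `□^{∼4}` ∘ S1 axial reach — located, printed TYPE; NOT
    -- asserted) — REPLACES the window-support binder `hFsupp` of S76 f2
    (hreach : ∀ V y, u (fixTo T U₀ (updateFinset V Λ y)) < εθ * η ^ 2 →
      ∀ b (hb : b ∈ Λ), dist1 ((c V b)⁻¹ * y ⟨b, hb⟩) ≤ 2 * Real.sin (S / 2))
    (hs₁ : κc * ((ε₄ + B₀ * (2 * dL * C₁ * ε₁)) + B₀ * (4 * C₂ * (ε₄ + B₀ * (2 * dL * C₁ * ε₁)) ^ 2)) ≤ c₁ * η ^ 2 * z)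
    (ha : κr * ((ε₄ + B₀ * (2 * dL * C₁ * ε₁)) + B₀ * (4 * C₂ * (ε₄ + B₀ * (2 * dL * C₁ * ε₁)) ^ 2)) ≤ c₂ * η * z)
    (hma : m * (κr * ((ε₄ + B₀ * (2 * dL * C₁ * ε₁)) + B₀ * (4 * C₂ * (ε₄ + B₀ * (2 * dL * C₁ * ε₁)) ^ 2))) ≤ 1)
    (hsm : 36 * (c₁ * z + m ^ 2 * c₂ ^ 2 * z ^ 2) / (rΦ / S - 1) ^ 2 ≤ δ * εθ) :
    SlotAntiConcentration ((fieldMeasure P j SU2).withDensity F) u (εθ * η ^ 2) ρ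
      (2 * ((m₀ : ℝ) + (BW + BE)) / (1 - δ)) := by
  -- numbers: the chart radius in window units, the threshold, (SM) in the Stokes currency (S73)
  have hRad1 : 1 < rΦ / S := by rw [lt_div_iff₀ hS]; linarith
  have hθ : 0 < εθ * η ^ 2 := by positivity
  have hκz : 0 ≤ κr * ((ε₄ + B₀ * (2 * dL * C₁ * ε₁)) + B₀ * (4 * C₂ * (ε₄ + B₀ * (2 * dL * C₁ * ε₁)) ^ 2)) := by
    positivity
  have hSM := hSM_of_stokes (δ := δ) hRad1 hη hκz hs₁ ha hma hsm
  -- the printed smallness gives the scheme numerics ((118)∕(121) at the ray; (54) at `ε₄ + 2dLB₀C₁ε₁`)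
  obtain ⟨hdom, hself, hcontr, -⟩ := scheme_numbers_of_printed hdL hB₀.le hC₁ hC₄ hε₁ hε₄ hB₃ h1 h2 h3
  have hself' : B₀ * C₄ * (ε₄ + B₀ * (2 * dL * C₁ * ε₁)) ^ 2 ≤ ε₄ := by simpa using hself
  have hcontr' : 4 * B₀ * C₄ * (ε₄ + B₀ * (2 * dL * C₁ * ε₁)) < 1 := by simpa using hcontr
  obtain ⟨hq, hRC⟩ := sectC_numbers_of_printed hC₂ hB₀.le h18 hcoup h3R
  -- the window points lie in the chart cube
  have hWc : ∀ V, ∀ x ∈ W V, x ∈ cube m₀ S := fun V x hx => mem_cube_of_mem_closedBall (hWS V hx)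
  -- S76 f2 for the RESTRICTED density with the indicator-multiplied co-test
  have h := slotAC_realized_su2_landauChart_final hT U₀ Λ e hS hSπ c
    (F := {U | u U < εθ * η ^ 2}.indicator F) (measurable_indicator_density hu _ hF)
    (fun g U => indicator_mul_invariant (fun U' => hui g U') (fun U' => hFi g U') U)
    (fun V y hne => by
      by_cases hlt : u (fixTo T U₀ (updateFinset V Λ y)) < εθ * η ^ 2
      · exact hreach V y hlt
      · exact absurd (indicator_of_notMem (show fixTo T U₀ (updateFinset V Λ y) ∉ {U | u U < εθ * η ^ 2} from hlt) F)
          hne)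
    hu hui hPu W
    (fun V x => {x' | u (fixTo T U₀ (updateFinset V Λ (expFibreChart Λ (c V) e x'))) < εθ * η ^ 2}.indicator (Jco V) x)
    𝒢 W𝒱 h𝒢 hW hB₀ hC₄ hε₄ hdL hC₁ hε₁ hB₃ h1 h2 h3 H₁ hH₁ Φ hΦd hΦ0 hΦ hSr Cf hC₂ hCq hCd ιs hι Hop hH h18 hcoup h3R
    ℓs hκ hℓ hlen hκc hcurl 𝓔W 𝓔E hEW hBW hEE hBE hWlb hElb L 𝓡𝒵 𝓡𝒴' 𝓡𝒳 h𝓡𝒳 𝓡ℬ h𝒢r hWr hιr hHr hCr hH₁r hΦr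
    (fun V x hx => by
      -- the restricted density's sections: S87 f1 `indicator_mul_section` against `hRdict`
      by_cases hlt : u (fixTo T U₀ (updateFinset V Λ (expFibreChart Λ (c V) e x))) < εθ * η ^ 2
      · rw [indicator_of_mem (show fixTo T U₀ (updateFinset V Λ (expFibreChart Λ (c V) e x)) ∈
            {U | u U < εθ * η ^ 2} from hlt),
          indicator_of_mem (show x ∈ {x' | u (fixTo T U₀ (updateFinset V Λ (expFibreChart Λ (c V) e x'))) <
            εθ * η ^ 2} from hlt), hRdict V x hx]
      · rw [indicator_of_notMem (show fixTo T U₀ (updateFinset V Λ (expFibreChart Λ (c V) e x)) ∉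
            {U | u U < εθ * η ^ 2} from hlt),
          indicator_of_notMem (show x ∉ {x' | u (fixTo T U₀ (updateFinset V Λ (expFibreChart Λ (c V) e x'))) <
            εθ * η ^ 2} from hlt), zero_mul])
    hudict
    (fun V x hne => hJW V x fun h0 => hne (le_antisymm ((indicator_le_self _ _ x).trans_eq h0) bot_le))
    (fun V x a ha => by
      -- CENTRE-MONOTONICITY of the extra indicator: the sub-threshold set is star-shaped along the contraction (§2)
      by_cases hJx : Jco V x = 0
      · have h0 : {x' | u (fixTo T U₀ (updateFinset V Λ (expFibreChart Λ (c V) e x'))) < εθ * η ^ 2}.indicator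
            (Jco V) x = 0 := le_antisymm ((indicator_le_self _ _ x).trans_eq hJx) bot_le
        rw [h0]; exact bot_le
      by_cases hlt : u (fixTo T U₀ (updateFinset V Λ (expFibreChart Λ (c V) e x))) < εθ * η ^ 2
      · have hxW : x ∈ W V := hJW V x hJx
        have hxc : x ∈ cube m₀ S := hWc V x hxW
        have hxc' : Real.exp (-a) • x ∈ cube m₀ S :=
          mem_cube_of_mem_closedBall (exp_neg_smul_mem_closedBall (hWS V hxW) ha)
        have hc1 : Real.exp (-a) ≤ 1 := by rw [Real.exp_le_one_iff]; linarith
        have hlt1 := hlt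
        rw [hudict V x hxc] at hlt1
        have hlt2 := classifier_lt_of_contraction hPu _ hRad1 hθ hδ0 hδ1.le hSM
          (hAN_landau_chartRay_stokes hS (hWS V) (h𝒢 V) (hW V) hB₀ hC₄ hε₄ hdom hself' hcontr' (H₁ V) (hH₁ V)
            (hΦd V) (hΦ0 V) (hΦ V) hSr hC₂ (hCq V) (hCd V) (ιs V) (hι V) (Hop V) (hH V) hq hRC ℓs hκ hℓ hκc hcurl
            hlen x hxW)
          hlt1 (Real.exp_pos (-a)) hc1
        rw [← hudict V (Real.exp (-a) • x) hxc'] at hlt2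
        rw [indicator_of_mem (show x ∈ {x' | u (fixTo T U₀ (updateFinset V Λ (expFibreChart Λ (c V) e x'))) <
            εθ * η ^ 2} from hlt),
          indicator_of_mem (show Real.exp (-a) • x ∈ {x' | u (fixTo T U₀ (updateFinset V Λ
            (expFibreChart Λ (c V) e x'))) < εθ * η ^ 2} from hlt2)]
        exact hJ V x a ha
      · rw [indicator_of_notMem (show x ∉ {x' | u (fixTo T U₀ (updateFinset V Λ (expFibreChart Λ (c V) e x'))) <
            εθ * η ^ 2} from hlt)]
        exact bot_le)
    (fun V x => (indicator_le_self _ _ x).trans (hJ1 V x))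
    hWS hδ0 hδ1 hρ0 hρ hβ hη hεθ hs₁ ha hma hsm
  -- S87 f1: (M1) for the restricted density ⟹ (M1) for the density, SAME constant
  exact slotAntiConcentration_withDensity_of_indicator hu (by positivity) hρ0 h

end Final

end Summit.QuantumFields.BalabanUV.T4Continuum.ShellMeasureLandauEndWindowRestrict

end
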